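import Mathlib
import Literature.NumberTheory.Automorphic.HilbertModularFormQExpansion
import Summits.Langlands.Langlands.Theorems.CapacityClassicalityHilbertIntegralOverconvergentIsCongruenceFourierKoecher
import Summits.Langlands.Langlands.Theorems.CapacityClassicalityHilbertIntegralOverconvergentIsCongruenceStubFourierCoeffAtOfHasSum

/-!
# Fourier coefficients of `f(δz)` (stub U2 of line Sketch-ideate-r1-k1)

Stub U2 `stub_smulArg_fourierCoeff` of line Sketch-ideate-r1-k1 (section U, RESHAPE 17) for the crux
`HilbertIntegralOverconvergentIsCongruence` (stmt-Langlands-8485), in the vocabulary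
`Literature.NumberTheory.Automorphic.HilbertModular`: for `F` totally real, `f` holomorphic and `𝓞 F`-periodic on
`ℍ^{Hom(F,ℝ)}` and `δ ∈ 𝓞 F` totally positive, the Fourier coefficients of the `V_δ`-image `z ↦ f(δz)`,
`(δz)_σ = σ(δ) z_σ`, at a dual-lattice index `μ ∈ 𝔡⁻¹ = {ν : Tr(ν a) ∈ ℤ ∀ a ∈ 𝓞 F}` are
`a_μ(f(δ·)) = a_{μ/δ}(f)` if `μ/δ ∈ 𝔡⁻¹` and `0` otherwise.

Proof outline.  Put `g(z) = f(δz)` and `b(ν) = a_{ν/δ}(f)` if `ν/δ ∈ 𝔡⁻¹`, `b(ν) = 0` otherwise.  For a cube point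
`w = x + i·1` the point `δw` lies in `ℍ` (`Im (δw)_σ = σ(δ) > 0`), so the landed Fourier expansion
(`hasSum_fourierCoeff`, Freitag I.4.1) gives `g(w) = f(δw) = ∑_{ν ∈ 𝔡⁻¹} a_ν(f) e^{2πi S(ν δw)}` together with
`∑_ν |a_ν| e^{-2π ∑_σ σ(ν) σ(δ)} < ∞`.  Since `S(ν δw) = S((δν) w)` and `ν ↦ δν` is an injection of `𝔡⁻¹` into itself
whose range is `{μ : μ/δ ∈ 𝔡⁻¹}` (on which `b(δν) = a_ν`, and off which `b = 0`), reindexing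
(`Function.Injective.hasSum_iff` / `summable_iff`) yields `g(w) = ∑_{μ ∈ 𝔡⁻¹} b(μ) e^{2πi S(μw)}` on the whole
height-`1` slice with `∑_μ |b(μ)| e^{-2π⟨μ,1⟩} < ∞`; the landed uniqueness of `q`-expansion coefficients
(`stub_fourierCoeffAt_of_hasSum`) then gives `a_μ(g) = b(μ)`, which is the claim.
-/

set_option linter.dupNamespace false

noncomputable section

namespace Summit.Langlands.Langlands.Theorems.HilbertIntegralOverconvergentIsCongruence

open MeasureTheory Complex NumberField
open Literature.NumberTheory.Automorphic Literature.NumberTheory.Automorphic.HilbertModular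

/-- A totally positive element of a totally real number field is non-zero (there is a real embedding). -/
theorem saf_ne_zero_of_totallyPositive (F : Type) [Field F] [NumberField F] [NumberField.IsTotallyReal F]
    (d : F) (hd : ∀ σ : F →+* ℝ, 0 < σ d) : d ≠ 0 := by
  obtain ⟨φ⟩ := (inferInstance : Nonempty (F →+* ℂ))
  intro h
  have := hd (NumberField.IsTotallyReal.complexEmbedding_isReal φ).embedding
  rw [h, map_zero] at this
  exact lt_irrefl _ this

/-- The dual lattice `𝔡⁻¹ = {ν : Tr(ν a) ∈ ℤ ∀ a ∈ 𝓞 F}` is an `𝓞 F`-module: `δ ∈ 𝓞 F`, `ν ∈ 𝔡⁻¹ ⇒ δν ∈ 𝔡⁻¹`. -/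
theorem saf_mul_mem_dualLattice (F : Type) [Field F] [NumberField F] (δ : 𝓞 F) {ν : F}
    (hν : ∀ a : 𝓞 F, ∃ n : ℤ, Algebra.trace ℚ F (ν * a) = n) (a : 𝓞 F) :
    ∃ n : ℤ, Algebra.trace ℚ F ((δ : F) * ν * a) = n := by
  obtain ⟨n, hn⟩ := hν (δ * a)
  refine ⟨n, ?_⟩
  rw [← hn]
  push_cast
  congr 1
  ring

/-- The pairing `S(νz) = ∑_σ σ(ν) z_σ` at the rescaled point `δz`: `S(ν (δz)) = S((δν) z)`. -/
theorem saf_pairing_smulArg (F : Type) [Field F] [NumberField F] (δ ν : F) (z : Point F) :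
    pairing ν (fun σ ↦ ((σ δ : ℝ) : ℂ) * z σ) = pairing (δ * ν) z := by
  simp only [pairing, map_mul]
  push_cast
  exact Finset.sum_congr rfl fun σ _ ↦ by ring

/-- **Stub U2 — `stub_smulArg_fourierCoeff`** (Fourier coefficients of `f(δz)`).  For `F` totally real, `f` holomorphic
and `𝓞 F`-periodic on `ℍ`, and `δ ∈ 𝓞 F` totally positive: at a dual-lattice index `μ`, the Fourier coefficient of
`z ↦ f(δz)` is `a_{μ/δ}(f)` if `μ/δ` lies in the dual lattice and `0` otherwise (expand `f` at `δz` by the landed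
`hasSum_fourierCoeff`, reindex `ν ↦ δν`, and read off coefficients with the landed uniqueness
`stub_fourierCoeffAt_of_hasSum`). [folklore] -/
theorem stub_smulArg_fourierCoeff (F : Type) [Field F] [NumberField F] [NumberField.IsTotallyReal F]
    (f : Point F → ℂ) (hf : IsHolomorphicOn F f)
    (hper : ∀ (a : 𝓞 F) (z : Point F), z ∈ halfSpace F → f (fun σ ↦ z σ + ((σ (a : F) : ℝ) : ℂ)) = f z)
    (δ : 𝓞 F) (hδ : ∀ σ : F →+* ℝ, 0 < σ (δ : F)) (μ : F)
    (hμ : ∀ a : 𝓞 F, ∃ n : ℤ, Algebra.trace ℚ F (μ * a) = n) :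
    ((∀ a : 𝓞 F, ∃ n : ℤ, Algebra.trace ℚ F (μ / (δ : F) * a) = n) →
      fourierCoeff (fun z : Point F ↦ f (fun σ ↦ ((σ (δ : F) : ℝ) : ℂ) * z σ)) μ = fourierCoeff f (μ / (δ : F))) ∧
    ((¬ ∀ a : 𝓞 F, ∃ n : ℤ, Algebra.trace ℚ F (μ / (δ : F) * a) = n) →
      fourierCoeff (fun z : Point F ↦ f (fun σ ↦ ((σ (δ : F) : ℝ) : ℂ) * z σ)) μ = 0) := by
  classical
  -- notation: the dual lattice `D`, the image `g = f(δ·)`, the candidate coefficients `b`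
  set D : Set F := {ν : F | ∀ a : 𝓞 F, ∃ n : ℤ, Algebra.trace ℚ F (ν * a) = n}
  set g : Point F → ℂ := fun z ↦ f (fun σ ↦ ((σ (δ : F) : ℝ) : ℂ) * z σ)
  set b : F → ℂ := fun ν ↦
    if (∀ a : 𝓞 F, ∃ n : ℤ, Algebra.trace ℚ F (ν / (δ : F) * a) = n) then fourierCoeff f (ν / (δ : F)) else 0
    with hbdef
  have hδ0 : (δ : F) ≠ 0 := saf_ne_zero_of_totallyPositive F (δ : F) hδ
  -- the injection `ν ↦ δν` of the dual lattice into itself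
  have hmemD : ∀ ν : D, (δ : F) * ν ∈ D := fun ν a ↦ saf_mul_mem_dualLattice F δ ν.2 a
  set ι : D → D := fun ν ↦ ⟨(δ : F) * ν, hmemD ν⟩
  have hιval : ∀ ν : D, ((ι ν : D) : F) = (δ : F) * ν := fun ν ↦ rfl
  have hι : Function.Injective ι := fun ν₁ ν₂ h ↦
    Subtype.ext (mul_left_cancel₀ hδ0 (by rw [← hιval, ← hιval, h]))
  -- `b ∘ ι = a` and `b = 0` off the range of `ι`
  have hbι : ∀ ν : D, b (ι ν) = fourierCoeff f ν := by
    intro ν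
    have h1 : ((ι ν : D) : F) / (δ : F) = ν := by rw [hιval]; exact mul_div_cancel_left₀ _ hδ0
    simp only [hbdef]
    rw [h1]
    exact if_pos ν.2
  have hrange : ∀ m : D, m ∉ Set.range ι → b m = 0 := by
    intro m hm
    have hnot : ¬ ∀ c : 𝓞 F, ∃ n : ℤ, Algebra.trace ℚ F ((m : F) / (δ : F) * c) = n := fun h ↦
      hm ⟨⟨(m : F) / δ, h⟩, Subtype.ext (by rw [hιval]; exact mul_div_cancel₀ (m : F) hδ0)⟩
    simp only [hbdef]
    exact if_neg hnot
  -- the expansion of `g` on the height-`1` slice, reindexed along `ι`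
  have hexp : ∀ x : Coord F,
      HasSum (fun m : D ↦ b m * cexp (2 * Real.pi * I * pairing (m : F) (cubePoint x fun _ ↦ (1 : ℝ))))
        (g (cubePoint x fun _ ↦ (1 : ℝ))) ∧
      Summable (fun m : D ↦ ‖b m‖ * Real.exp (-(2 * Real.pi * ∑ σ : F →+* ℝ, σ (m : F) * (1 : ℝ)))) := by
    intro x
    set w : Point F := cubePoint x fun _ ↦ (1 : ℝ)
    have hw_im : ∀ σ, (w σ).im = 1 := fun σ ↦ koe_cubePoint_im x (fun _ ↦ (1 : ℝ)) σ
    have hLw_im : ∀ σ : F →+* ℝ, (((σ (δ : F) : ℝ) : ℂ) * w σ).im = σ (δ : F) := by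
      intro σ
      rw [Complex.im_ofReal_mul, hw_im, mul_one]
    have hLw : (fun σ ↦ ((σ (δ : F) : ℝ) : ℂ) * w σ) ∈ halfSpace F := fun σ ↦ by
      rw [hLw_im]
      exact hδ σ
    obtain ⟨hs, ha⟩ := hasSum_fourierCoeff F f hf hper _ hLw
    refine ⟨?_, ?_⟩
    · refine (hι.hasSum_iff fun m hm ↦ ?_).1 ?_
      · rw [hrange m hm, zero_mul]
      · refine hs.congr_fun fun ν ↦ ?_
        rw [Function.comp_apply, hbι ν, hιval ν, saf_pairing_smulArg]
    · refine (hι.summable_iff fun m hm ↦ ?_).1 ?_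
      · rw [hrange m hm, norm_zero, zero_mul]
      · refine ha.congr fun ν ↦ ?_
        rw [Function.comp_apply, hbι ν, hιval ν]
        congr 4
        exact Finset.sum_congr rfl fun σ _ ↦ by rw [hLw_im, map_mul]; ring
  -- uniqueness of coefficients
  have key : fourierCoeff g μ = b μ := by
    rw [fourierCoeff_eq]
    exact stub_fourierCoeffAt_of_hasSum F g b (fun _ ↦ 1) (fun x ↦ (hexp x).1) (hexp 0).2 μ hμ
  refine ⟨fun h ↦ ?_, fun h ↦ ?_⟩
  · rw [key]
    simp only [hbdef]
    exact if_pos h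
  · rw [key]
    simp only [hbdef]
    exact if_neg h

end Summit.Langlands.Langlands.Theorems.HilbertIntegralOverconvergentIsCongruence
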